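import Summits.BirchSwinnertonDyer.BirchSwinnertonDyer.Theses.VerticalContact
import Literature.NumberTheory.EllipticCurves.BSDSelmerParityDokchitserProofs

/-!
# BirchSwinnertonDyer / VerticalContact — crux `PGSelmerBSD` (stmt-BirchSwinnertonDyer-17810):
# negative lemmas — no hypothesis is load-bearing for truth, and the SHAPE of a counterexample
# (standing disprover, cycle 1)

The crux is `∀ W [IsElliptic] [IsGloballyMinimal], (¬ ∃ q prime, multiplicative at q) →
∃ p prime, W.selmerCorank p = W.analyticRank`. The disprover's usual move — drop a hypothesis `H`,
exhibit a witness, land `<crux>_false_without_H` — is IMPOSSIBLE here for the sector hypothesis and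
for global minimality, and this file records WHY, together with where a counterexample would have to
live, as kernel-checked theorems that assert NO route statement positively and introduce no
definition. Engine: Greenberg's corank identity `corank Sel_{p^∞} = rank + corank Ш[p^∞]`, a THEOREM
of the tree (`WeierstrassCurve.selmerCorank_eq_mordellWeilRank_add_holds`), plus — as explicit
hypotheses where used — the named facts Gross–Zagier–Kolyvagin
(`rank_eq_analyticRank_of_analyticRank_le_one`) and Dokchitser `p`-parity (`selmerCorank_mod_two_eq`).

* `PGSelmerBSDNegative.not_summit_or_sha_wild_of_not` — **a counterexample to the crux refutes the
  Lean summit `BirchSwinnertonDyer` or is an elliptic curve whose `Ш[p^∞]` is INFINITE AT EVERY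
  PRIME** (unconditional). Hence the hypotheses (sector, minimality) are provability scaffolding, not
  truth conditions, and the crux cannot be "refuted-misstated" on their account.
* `PGSelmerBSDNegative.not_shaPFinite_of_summit_of_not` — given the summit, a counterexample refutes
  the route's own item `SelmerRankShaPFinite` (stmt-0132).
* `PGSelmerBSDNegative.counterexample_dichotomy` — at every prime: `rank ≤ corank_p`, and BSD-rank
  fails at `W` or `corank Ш(W)[p^∞] ≥ 1` (unconditional).
* `PGSelmerBSDNegative.counterexample_shape` — modulo GZK and `p`-parity: `r_an(W) ≥ 2` and at every
  prime the gap `|corank_p − r_an|` is even and `≥ 2`.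
* `PGSelmerBSDNegative.counterexample_sha_of_rank_eq` — modulo `p`-parity: if moreover
  `rank W = r_an W`, then `corank Ш(W)[p^∞] ≥ 2` for ALL primes (`(ℚ_p/ℤ_p)² ⊆ Ш(W)` everywhere — no
  known instance, heuristic or numerical signature).
* `PGSelmerBSDNegative.exists_core_witness_of_not` — modulo GZK, a counterexample lies in the
  `r_an ≥ 2` slice of the sector (the `r_an ≤ 1` slice of the crux holds at every prime).
Full adversarial record: `Cruxes/PGSelmerBSD/Disproof.lean`.
Refuter seat refuter-cdisprove-stmt-BirchSwinnertonDyer-17810-0, 2026-08-17.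
-/

set_option linter.dupNamespace false

noncomputable section

open scoped Classical

namespace Summit.BirchSwinnertonDyer.BirchSwinnertonDyer.Theorems

open Summit.BirchSwinnertonDyer.BirchSwinnertonDyer.Theses
open Literature.NumberTheory.EllipticCurves WeierstrassCurve

/-- **A counterexample to `PGSelmerBSD` refutes the summit or carries Ш infinite at every prime.**
If the crux fails, then either `BirchSwinnertonDyer` (`r_an = rank` for every elliptic `W/ℚ`) fails,
or some elliptic, globally minimal `W` in the sector has `Ш(W)[p^∞]` infinite for EVERY prime `p`:
for if `r_an(W) = rank(W)` and `Ш(W)[p^∞]` is finite at one `p`, the proved identity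
`corank_p = rank + corank Ш[p^∞]` gives `corank_p = r_an` there. [cite: GreenbergLNM1716, §1] -/
theorem PGSelmerBSDNegative.not_summit_or_sha_wild_of_not (h : ¬ VerticalContact.PGSelmerBSD) :
    ¬ _root_.BirchSwinnertonDyer ∨
      ∃ (W : WeierstrassCurve ℚ) (_ : W.IsElliptic) (_ : W.IsGloballyMinimal),
        (¬ ∃ (q : ℕ) (_ : Fact q.Prime), W.HasMultiplicativeReductionAtPrime q) ∧
          ∀ (p : ℕ) [Fact p.Prime], ¬ Finite ↥(AddCommGroup.primaryComponent W.sha p) := by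
  by_contra hcon
  rw [not_or, not_not] at hcon
  obtain ⟨hS, hSha⟩ := hcon
  apply h
  intro W _ _ hW
  by_contra hnone
  apply hSha
  refine ⟨W, ‹_›, ‹_›, hW, fun p _ hfin => hnone ⟨p, ‹_›, ?_⟩⟩
  have h1 := W.selmerCorank_eq_mordellWeilRank_add_holds p
  have h2 : W.shaCorank p = 0 := Literature.BSD.shaCorank_eq_zero_of_finite W p hfin
  have h3 : W.analyticRank = W.mordellWeilRank :=
    (show ∀ V : WeierstrassCurve ℚ, V.IsElliptic → V.analyticRank = V.mordellWeilRank from hS) W ‹_›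
  omega

/-- **Given the summit, a counterexample to the crux refutes the route's item `SelmerRankShaPFinite`
(stmt-0132)** — indeed it produces a curve with `Ш[p^∞]` infinite at every prime, let alone one.
[cite: GreenbergLNM1716, §1] -/
theorem PGSelmerBSDNegative.not_shaPFinite_of_summit_of_not (hS : _root_.BirchSwinnertonDyer)
    (h : ¬ VerticalContact.PGSelmerBSD) : ¬ VerticalContact.SelmerRankShaPFinite := by
  intro hSha
  rcases PGSelmerBSDNegative.not_summit_or_sha_wild_of_not h with hnS | ⟨W, hE, -, -, hW⟩
  · exact hnS hS
  · haveI := hE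
    haveI : Fact (Nat.Prime 2) := ⟨Nat.prime_two⟩
    exact hW 2 (hSha W 2)

/-- **Unconditional shape of a counterexample.** If no prime has `corank_p = r_an` at `W`, then at
EVERY prime `rank ≤ corank_p` (Kummer) and either BSD-rank fails at `W` or `corank Ш(W)[p^∞] ≥ 1`.
Only the proved corank identity is used. [cite: GreenbergLNM1716, §1] -/
theorem PGSelmerBSDNegative.counterexample_dichotomy (W : WeierstrassCurve ℚ) [W.IsElliptic]
    (hW : ∀ (p : ℕ) [Fact p.Prime], W.selmerCorank p ≠ W.analyticRank) (p : ℕ) [Fact p.Prime] :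
    W.mordellWeilRank ≤ W.selmerCorank p ∧
      (W.analyticRank ≠ W.mordellWeilRank ∨ 1 ≤ W.shaCorank p) := by
  have h1 := W.selmerCorank_eq_mordellWeilRank_add_holds p
  have h2 := hW p
  refine ⟨by omega, ?_⟩
  by_cases h : W.analyticRank = W.mordellWeilRank
  · right; omega
  · left; exact h

/-- **Shape modulo Gross–Zagier–Kolyvagin and `p`-parity** (named facts, as hypotheses): a curve
defeating the crux has `r_an ≥ 2`, and at every prime `corank_p` differs from `r_an` by an EVEN
amount `≥ 2` — first open cells `(corank_p, r_an) ∈ {(0,2), (4,2), (1,3), (5,3), (2,4), …}` at a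
general prime (the corank-0/1 `p`-converses push this to `min ≥ 2` at admissible primes).
[cite: Darmon2004, Thm. 3.22] [cite: DokchitserDokchitserAnnals2010, Thm. 1.4] -/
theorem PGSelmerBSDNegative.counterexample_shape (hGZK : rank_eq_analyticRank_of_analyticRank_le_one)
    (hPar : ∀ (W : WeierstrassCurve ℚ) [W.IsElliptic] (p : ℕ) [Fact p.Prime], selmerCorank_mod_two_eq W p)
    (W : WeierstrassCurve ℚ) [W.IsElliptic]
    (hW : ∀ (p : ℕ) [Fact p.Prime], W.selmerCorank p ≠ W.analyticRank) :
    2 ≤ W.analyticRank ∧ ∀ (p : ℕ) [Fact p.Prime],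
      W.selmerCorank p + 2 ≤ W.analyticRank ∨ W.analyticRank + 2 ≤ W.selmerCorank p := by
  refine ⟨?_, fun p _ => ?_⟩
  · by_contra hlt
    haveI : Fact (Nat.Prime 2) := ⟨Nat.prime_two⟩
    exact hW 2 (selmerCorank_eq_analyticRank_of_analyticRank_le_one hGZK W 2 (by omega))
  · have hpar : W.selmerCorank p % 2 = W.analyticRank % 2 := hPar W p
    have hne := hW p
    omega

/-- **If BSD-rank holds at the counterexample, Ш is wild at EVERY prime** (modulo `p`-parity):
`rank W = r_an W` and no prime with `corank_p = r_an` force `corank Ш(W)[p^∞] ≥ 2` for all `p`.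
[cite: DokchitserDokchitserAnnals2010, Thm. 1.4] -/
theorem PGSelmerBSDNegative.counterexample_sha_of_rank_eq
    (hPar : ∀ (W : WeierstrassCurve ℚ) [W.IsElliptic] (p : ℕ) [Fact p.Prime], selmerCorank_mod_two_eq W p)
    (W : WeierstrassCurve ℚ) [W.IsElliptic] (hrank : W.analyticRank = W.mordellWeilRank)
    (hW : ∀ (p : ℕ) [Fact p.Prime], W.selmerCorank p ≠ W.analyticRank) (p : ℕ) [Fact p.Prime] :
    2 ≤ W.shaCorank p := by
  have h1 := W.selmerCorank_eq_mordellWeilRank_add_holds p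
  have hpar : W.selmerCorank p % 2 = W.analyticRank % 2 := hPar W p
  have hne := hW p
  omega

/-- **The open core, negatively** (modulo GZK): if the crux fails, it fails at an elliptic, globally
minimal curve of the sector with `r_an ≥ 2` and no prime of equality — the `r_an ≤ 1` slice holds at
every prime (`selmerCorank_eq_analyticRank_of_analyticRank_le_one`). [cite: Darmon2004, Thm. 3.22] -/
theorem PGSelmerBSDNegative.exists_core_witness_of_not (hGZK : rank_eq_analyticRank_of_analyticRank_le_one)
    (h : ¬ VerticalContact.PGSelmerBSD) :
    ∃ (W : WeierstrassCurve ℚ) (_ : W.IsElliptic) (_ : W.IsGloballyMinimal),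
      (¬ ∃ (q : ℕ) (_ : Fact q.Prime), W.HasMultiplicativeReductionAtPrime q) ∧ 2 ≤ W.analyticRank ∧
        ∀ (p : ℕ) [Fact p.Prime], W.selmerCorank p ≠ W.analyticRank := by
  by_contra hcon
  apply h
  intro W _ _ hW
  by_cases hr : W.analyticRank ≤ 1
  · exact ⟨2, ⟨Nat.prime_two⟩, selmerCorank_eq_analyticRank_of_analyticRank_le_one hGZK W 2 hr⟩
  · by_contra hnone
    exact hcon ⟨W, ‹_›, ‹_›, hW, by omega, fun p _ hEq => hnone ⟨p, ‹_›, hEq⟩⟩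

end Summit.BirchSwinnertonDyer.BirchSwinnertonDyer.Theorems

end
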